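import Summits.QuantumAdvantage.QuantumAdvantage.Theses.RandomOracleGauge
import Summits.QuantumAdvantage.QuantumAdvantage.Theorems.SosSandwichPseudoBoundedAALevelKRung
import Literature.Computability.QuantumComplexity.InfluenceBounds

/-!
# Crux `OneBlockDecoupling` (stmt-QuantumAdvantage-17873, route RandomOracleGauge), line `odonnell-zhao` — stub `stub_comparison`, part 1/2 (moments)

O'Donnell–Zhao, *Polynomial bounds for decoupling, with applications*, arXiv:1512.01603, proof of Thm. 2.13
(the Parseval comparison). Let `p̂ = cubeFourierCoeff (evalBool p)` and let `q ∈ ℝ[Fin (N+N)]` realise, on the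
glued cube `(y,z) ↦ Fin.append y z`, the rescaled one-block-decoupled function

  `q(y,z) = 1/2 + dec p (y,z)/(2C)`,  `dec p (y,z) = Σ_S p̂(S) Σ_{i∈S} sgn(y_i) Π_{j∈S∖i} sgn(z_j)`.

Writing `dec p (y,z) = Σ_i sgn(y_i) G_i(z)` with `G_i(z) = Σ_{S∋i} p̂(S) χ_{S∖i}(z)`, orthogonality of the
`sgn(y_i)` over `y` and Parseval for each `G_i` over `z` (the sets `S∖i`, `S ∋ i`, are distinct) give

* `E q = 1/2`, **`Var q = (1/16C²) Σ_i Inf_i[p] ≥ Var p/(4C²)`** (`Σ_i Inf_i = 4 Σ_S |S| p̂(S)² ≥ 4 Var p`);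
* **`Inf_{y_i} q = Inf_i[p]/(4C²)`** (flipping `y_i` flips the sign of the `i`-th term only);
* **`Inf_{z_k} q = (1/C²) Σ_{S∋k} (|S|−1) p̂(S)² ≤ (d/4C²) Inf_k[p]`** (flipping `z_k` flips `χ_{S∖i}` for
  `S ∋ k`, `i ≠ k`; a polynomial of total degree `≤ d` has no Walsh weight above level `d`).

THIS PART (1/2): the glued-cube and Walsh bookkeeping (`sum_cube_append`, `flipBit_castAdd_append`,
`flipBit_natAdd_append`, `sum_sq_sum_sgn`, `slice_eq_walsh`, `sum_sq_slice`, `sum_sq_slice_sub_flip`,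
`sum_flip_coeff_sq_le`, `dec_eq_sum_slices`), the mean and **variance identity** (`boolAvg_realised`,
`boolVariance_realised`). Part 2/2
(`…StubComparison.lean`) does the influences and the registered stub `stub_comparison` BY NAME.
Elementary cube bookkeeping over the tree's Walsh toolkit (`BooleanFourier`, `InfluenceBounds`); no named facts,
no new definitions.
-/

-- D-0017: single-conjunct summit ⇒ the duplicate `QuantumAdvantage.QuantumAdvantage` is mandated.
set_option linter.dupNamespace false

noncomputable section

open Finset
open Literature.Computability.QuantumComplexity
open Literature.Probability.RandomGraphs.LowDegree (sgn walsh)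
open Literature.Computability.Complexity.LowDegree (cubeFourierCoeff)
open Summit.QuantumAdvantage.QuantumAdvantage.Theses.RandomOracleGauge

namespace Summit.QuantumAdvantage.QuantumAdvantage.Cruxes.OneBlockDecoupling.OdonnellZhao

namespace StubComparison

variable {N : ℕ}

/-! ### The glued cube `Fin (N+N) = y-block ⊔ z-block` -/

/-- A sum over the `(N+N)`-cube is a double sum over the two blocks. [folklore] -/
theorem sum_cube_append (F : (Fin (N + N) → Bool) → ℝ) :
    ∑ x, F x = ∑ y : Fin N → Bool, ∑ z : Fin N → Bool, F (Fin.append y z) := by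
  rw [← Fintype.sum_prod_type']
  exact (Fintype.sum_equiv (Fin.appendEquiv N N) _ _ fun _ => rfl).symm

/-- The two blocks are disjoint: `natAdd l ≠ castAdd i`. [folklore] -/
theorem natAdd_ne_castAdd (l i : Fin N) : Fin.natAdd N l ≠ Fin.castAdd N i := by
  intro e
  have h1 : (Fin.natAdd N l).val = (Fin.castAdd N i).val := by rw [e]
  have h2 : (Fin.natAdd N l).val = N + l.val := rfl
  have h3 : (Fin.castAdd N i).val = i.val := rfl
  have h4 := i.isLt
  omega

/-- Flipping a `y`-bit of a glued point. [folklore] -/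
theorem flipBit_castAdd_append (i : Fin N) (y z : Fin N → Bool) :
    flipBit (Fin.castAdd N i) (Fin.append y z) = Fin.append (flipBit i y) z := by
  funext l
  cases l using Fin.addCases with
  | left l =>
    show Function.update (Fin.append y z) (Fin.castAdd N i) (!(Fin.append y z (Fin.castAdd N i)))
        (Fin.castAdd N l) = Fin.append (flipBit i y) z (Fin.castAdd N l)
    rw [Fin.append_left, Fin.append_left]
    by_cases h : l = i
    · subst h
      rw [Function.update_self]
      show (!y l) = Function.update y l (!y l) l
      rw [Function.update_self]
    · have h' : Fin.castAdd N l ≠ Fin.castAdd N i := fun e => h (Fin.castAdd_injective _ _ e)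
      rw [Function.update_of_ne h', Fin.append_left]
      show y l = Function.update y i (!y i) l
      rw [Function.update_of_ne h]
  | right l =>
    show Function.update (Fin.append y z) (Fin.castAdd N i) (!(Fin.append y z (Fin.castAdd N i)))
        (Fin.natAdd N l) = Fin.append (flipBit i y) z (Fin.natAdd N l)
    rw [Function.update_of_ne (natAdd_ne_castAdd l i), Fin.append_right, Fin.append_right]

/-- Flipping a `z`-bit of a glued point. [folklore] -/
theorem flipBit_natAdd_append (k : Fin N) (y z : Fin N → Bool) :
    flipBit (Fin.natAdd N k) (Fin.append y z) = Fin.append y (flipBit k z) := by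
  funext l
  cases l using Fin.addCases with
  | left l =>
    show Function.update (Fin.append y z) (Fin.natAdd N k) (!(Fin.append y z (Fin.natAdd N k)))
        (Fin.castAdd N l) = Fin.append y (flipBit k z) (Fin.castAdd N l)
    rw [Function.update_of_ne (natAdd_ne_castAdd k l).symm, Fin.append_left, Fin.append_left]
  | right l =>
    show Function.update (Fin.append y z) (Fin.natAdd N k) (!(Fin.append y z (Fin.natAdd N k)))
        (Fin.natAdd N l) = Fin.append y (flipBit k z) (Fin.natAdd N l)
    rw [Fin.append_right, Fin.append_right]
    by_cases h : l = k
    · subst h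
      rw [Function.update_self]
      show (!z l) = Function.update z l (!z l) l
      rw [Function.update_self]
    · have h' : Fin.natAdd N l ≠ Fin.natAdd N k := fun e => h (Fin.natAdd_injective _ _ e)
      rw [Function.update_of_ne h', Fin.append_right]
      show z l = Function.update z k (!z k) l
      rw [Function.update_of_ne h]

/-! ### Walsh bookkeeping on one block -/

/-- Orthogonality of the degree-one characters: `Σ_y (Σ_i a_i sgn(y_i))² = 2^N Σ_i a_i²`. [cite: ODonnell2014, §1.4] -/
theorem sum_sq_sum_sgn (a : Fin N → ℝ) :
    ∑ y : Fin N → Bool, (∑ i, sgn (y i) * a i) ^ 2 = 2 ^ N * ∑ i, a i ^ 2 := by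
  have hw : ∀ (i : Fin N) (y : Fin N → Bool), sgn (y i) = walsh {i} y := by
    intro i y; simp [walsh]
  calc ∑ y : Fin N → Bool, (∑ i, sgn (y i) * a i) ^ 2
      = ∑ y : Fin N → Bool, ∑ i, ∑ k, a i * a k * (walsh {i} y * walsh {k} y) := by
        refine Finset.sum_congr rfl fun y _ => ?_
        rw [sq, Finset.sum_mul_sum]
        refine Finset.sum_congr rfl fun i _ => Finset.sum_congr rfl fun k _ => ?_
        rw [hw i y, hw k y]; ring
    _ = ∑ i, ∑ k, a i * a k * ∑ y : Fin N → Bool, walsh {i} y * walsh {k} y := by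
        rw [Finset.sum_comm]
        refine Finset.sum_congr rfl fun i _ => ?_
        rw [Finset.sum_comm]
        exact Finset.sum_congr rfl fun k _ => by rw [Finset.mul_sum]
    _ = ∑ i, a i * a i * 2 ^ N := by
        refine Finset.sum_congr rfl fun i _ => ?_
        simp_rw [Literature.Computability.Complexity.LowDegree.sum_walsh_mul_walsh_index,
          Finset.singleton_inj, mul_ite, mul_zero]
        rw [Finset.sum_ite_eq]; simp
    _ = 2 ^ N * ∑ i, a i ^ 2 := by
        rw [Finset.mul_sum]; exact Finset.sum_congr rfl fun i _ => by ring

/-- `Σ_y sgn(y_i) = 0`. [cite: ODonnell2014, §1.4] -/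
theorem sum_sgn_eq_zero (i : Fin N) : ∑ y : Fin N → Bool, sgn (y i) = 0 := by
  have h := Literature.Computability.Complexity.LowDegree.sum_walsh_mul_walsh_index ({i} : Finset (Fin N)) ∅
  have hne : ({i} : Finset (Fin N)) ≠ ∅ := Finset.singleton_ne_empty i
  rw [if_neg hne] at h
  simpa [walsh] using h

/-- Re-indexing `S ∋ i ↔ R = S ∖ i ∌ i`: `Σ_{R ∌ i} f(R ∪ {i}) = Σ_{S ∋ i} f(S)`. [folklore] -/
theorem sum_filter_not_mem_insert (i : Fin N) (f : Finset (Fin N) → ℝ) :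
    ∑ R ∈ Finset.univ.filter (fun R : Finset (Fin N) => i ∉ R), f (insert i R) =
      ∑ S ∈ Finset.univ.filter (fun S : Finset (Fin N) => i ∈ S), f S := by
  refine Finset.sum_nbij' (fun R => insert i R) (fun S => S.erase i) ?_ ?_ ?_ ?_ ?_
  · intro R _; simp
  · intro S _; simp
  · intro R hR
    rw [Finset.mem_filter] at hR
    exact Finset.erase_insert hR.2
  · intro S hS
    rw [Finset.mem_filter] at hS
    exact Finset.insert_erase hS.2
  · intro R _; rfl

/-- The `i`-th decoupled slice `G_i(z) = Σ_{S∋i} p̂(S) Π_{j∈S∖i} sgn(z_j)` as a Walsh series on the `z`-block: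
`G_i = Σ_R c_R χ_R` with `c_R = [i ∉ R]·p̂(R ∪ {i})`. [cite: ODonnellZhao2016, Def. 1.1] -/
theorem slice_eq_walsh (P : Finset (Fin N) → ℝ) (i : Fin N) (z : Fin N → Bool) :
    ∑ S : Finset (Fin N), (if i ∈ S then P S * ∏ j ∈ S.erase i, sgn (z j) else 0) =
      ∑ R : Finset (Fin N), (if i ∈ R then 0 else P (insert i R)) * walsh R z := by
  classical
  rw [← Finset.sum_filter, ← sum_filter_not_mem_insert i, Finset.sum_filter]
  refine Finset.sum_congr rfl fun R _ => ?_
  by_cases h : i ∈ R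
  · simp [h]
  · rw [if_pos h, if_neg h, Finset.erase_insert h]; rfl

/-- Parseval for the slice: `Σ_z G_i(z)² = 2^N Σ_{S∋i} p̂(S)²`. [cite: ODonnell2014, §1.4] -/
theorem sum_sq_slice (P : Finset (Fin N) → ℝ) (i : Fin N) :
    ∑ z : Fin N → Bool, (∑ S : Finset (Fin N), (if i ∈ S then P S * ∏ j ∈ S.erase i, sgn (z j) else 0)) ^ 2 =
      2 ^ N * ∑ S ∈ Finset.univ.filter (fun S : Finset (Fin N) => i ∈ S), P S ^ 2 := by
  classical
  simp_rw [slice_eq_walsh P i]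
  rw [sum_sq_sum_mul_walsh]
  congr 1
  rw [← sum_filter_not_mem_insert i (fun S => P S ^ 2), Finset.sum_filter]
  refine Finset.sum_congr rfl fun R _ => ?_
  by_cases h : i ∈ R <;> simp [h]

/-- Parseval for the flipped slice: `Σ_z (G_i(z) − G_i(z ⊕ e_k))² = 2^N · 4 · Σ_{R ∋ k, R ∌ i} p̂(R ∪ {i})²`.
[cite: ODonnell2014, §2.2] -/
theorem sum_sq_slice_sub_flip (P : Finset (Fin N) → ℝ) (i k : Fin N) :
    ∑ z : Fin N → Bool,
      ((∑ S : Finset (Fin N), (if i ∈ S then P S * ∏ j ∈ S.erase i, sgn (z j) else 0)) -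
        (∑ S : Finset (Fin N), (if i ∈ S then P S * ∏ j ∈ S.erase i, sgn (flipBit k z j) else 0))) ^ 2 =
      2 ^ N * ∑ R : Finset (Fin N), (if k ∈ R then 2 * (if i ∈ R then 0 else P (insert i R)) else 0) ^ 2 := by
  classical
  have hsub : ∀ z : Fin N → Bool,
      (∑ S : Finset (Fin N), (if i ∈ S then P S * ∏ j ∈ S.erase i, sgn (z j) else 0)) -
        (∑ S : Finset (Fin N), (if i ∈ S then P S * ∏ j ∈ S.erase i, sgn (flipBit k z j) else 0)) =
      ∑ R : Finset (Fin N), (if k ∈ R then 2 * (if i ∈ R then 0 else P (insert i R)) else 0) * walsh R z := by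
    intro z
    rw [slice_eq_walsh P i z, slice_eq_walsh P i (flipBit k z), ← Finset.sum_sub_distrib]
    refine Finset.sum_congr rfl fun R _ => ?_
    rw [walsh_flipBit]
    split_ifs <;> ring
  simp_rw [hsub]
  exact sum_sq_sum_mul_walsh _

/-- The flipped-slice weight is at most the `k`-row weight restricted to `S ∋ i`:
`Σ_R [k∈R] (2c_R)² ≤ 4 Σ_{S ∋ k} [i ∈ S] p̂(S)²`. [folklore] -/
theorem sum_flip_coeff_sq_le (P : Finset (Fin N) → ℝ) (i k : Fin N) :
    ∑ R : Finset (Fin N), (if k ∈ R then 2 * (if i ∈ R then 0 else P (insert i R)) else 0) ^ 2 ≤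
      4 * ∑ S ∈ Finset.univ.filter (fun S : Finset (Fin N) => k ∈ S), (if i ∈ S then P S ^ 2 else 0) := by
  classical
  -- rewrite the right-hand side over `R = S ∖ i`
  have hR : ∑ S ∈ Finset.univ.filter (fun S : Finset (Fin N) => k ∈ S), (if i ∈ S then P S ^ 2 else 0) =
      ∑ R ∈ Finset.univ.filter (fun R : Finset (Fin N) => i ∉ R),
        (if k ∈ insert i R then P (insert i R) ^ 2 else 0) := by
    rw [sum_filter_not_mem_insert i (fun S => if k ∈ S then P S ^ 2 else 0), Finset.sum_filter,
      Finset.sum_filter]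
    refine Finset.sum_congr rfl fun S _ => ?_
    by_cases h1 : i ∈ S <;> by_cases h2 : k ∈ S <;> simp [h1, h2]
  rw [hR, Finset.sum_filter, Finset.mul_sum]
  refine Finset.sum_le_sum fun R _ => ?_
  by_cases h1 : i ∈ R <;> by_cases h2 : k ∈ R
  · simp [h1, h2]
  · simp [h1, h2]
  · have h3 : k ∈ insert i R := Finset.mem_insert_of_mem h2
    rw [if_pos h2, if_neg h1, if_pos h1, if_pos h3]
    exact le_of_eq (by ring)
  · rw [if_neg h2, if_pos h1]
    have : (0 : ℝ) ≤ P (insert i R) ^ 2 := sq_nonneg _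
    split_ifs <;> linarith

/-! ### The decoupled function in sliced form -/

/-- `dec p (y,z) = Σ_i sgn(y_i) G_i(z)`. [cite: ODonnellZhao2016, Def. 1.1] -/
theorem dec_eq_sum_slices (P : Finset (Fin N) → ℝ) (y z : Fin N → Bool) :
    ∑ S : Finset (Fin N), P S * ∑ i ∈ S, sgn (y i) * ∏ j ∈ S.erase i, sgn (z j) =
      ∑ i, sgn (y i) * ∑ S : Finset (Fin N), (if i ∈ S then P S * ∏ j ∈ S.erase i, sgn (z j) else 0) := by
  classical
  have h1 : ∀ S : Finset (Fin N), P S * ∑ i ∈ S, sgn (y i) * ∏ j ∈ S.erase i, sgn (z j) =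
      ∑ i, sgn (y i) * (if i ∈ S then P S * ∏ j ∈ S.erase i, sgn (z j) else 0) := by
    intro S
    rw [Finset.mul_sum, ← Finset.sum_filter_add_sum_filter_not Finset.univ (fun i => i ∈ S)]
    have hf : Finset.univ.filter (fun i : Fin N => i ∈ S) = S := by ext i; simp
    have hnf : ∑ i ∈ Finset.univ.filter (fun i : Fin N => ¬ i ∈ S), sgn (y i) *
        (if i ∈ S then P S * ∏ j ∈ S.erase i, sgn (z j) else 0) = 0 :=
      Finset.sum_eq_zero fun i hi => by
        rw [Finset.mem_filter] at hi
        rw [if_neg hi.2, mul_zero]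
    rw [hf, hnf, add_zero]
    refine Finset.sum_congr rfl fun i hi => ?_
    rw [if_pos hi]; ring
  simp_rw [h1]
  rw [Finset.sum_comm]
  exact Finset.sum_congr rfl fun i _ => by rw [Finset.mul_sum]

/-! ### Moments of the realised polynomial -/

variable {p : MvPolynomial (Fin N) ℝ} {C : ℝ} {q : MvPolynomial (Fin (N + N)) ℝ}

/-- `E q = 1/2` (every decoupled character has mean zero). [cite: ODonnellZhao2016, proof of Thm. 2.13] -/
theorem boolAvg_realised
    (hq : ∀ (y z : Fin N → Bool), evalBool q (Fin.append y z) =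
      1 / 2 + (∑ S : Finset (Fin N), cubeFourierCoeff (evalBool p) S *
        ∑ i ∈ S, sgn (y i) * ∏ j ∈ S.erase i, sgn (z j)) / (2 * C)) :
    boolAvg (evalBool q) = 1 / 2 := by
  unfold boolAvg
  rw [sum_cube_append]
  simp_rw [hq, dec_eq_sum_slices]
  have hzero : ∑ y : Fin N → Bool, ∑ z : Fin N → Bool, (∑ i, sgn (y i) *
      ∑ S : Finset (Fin N), (if i ∈ S then cubeFourierCoeff (evalBool p) S *
        ∏ j ∈ S.erase i, sgn (z j) else 0)) / (2 * C) = 0 := by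
    rw [Finset.sum_comm]
    refine Finset.sum_eq_zero fun z _ => ?_
    rw [← Finset.sum_div, Finset.sum_comm]
    rw [Finset.sum_eq_zero fun i _ => ?_, zero_div]
    rw [← Finset.sum_mul, sum_sgn_eq_zero i, zero_mul]
  simp_rw [Finset.sum_add_distrib]
  rw [hzero, add_zero]
  simp only [Finset.sum_const, Finset.card_univ, Fintype.card_fun, Fintype.card_bool, Fintype.card_fin,
    nsmul_eq_mul]
  rw [pow_add]; push_cast; field_simp

/-- **Variance identity**: `Var q = (1/16C²) Σ_i Inf_i[p]`. [cite: ODonnellZhao2016, proof of Thm. 2.13] -/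
theorem boolVariance_realised (hC : 0 < C)
    (hq : ∀ (y z : Fin N → Bool), evalBool q (Fin.append y z) =
      1 / 2 + (∑ S : Finset (Fin N), cubeFourierCoeff (evalBool p) S *
        ∑ i ∈ S, sgn (y i) * ∏ j ∈ S.erase i, sgn (z j)) / (2 * C)) :
    boolVariance q = (∑ i, influence i p) / (16 * C ^ 2) := by
  unfold boolVariance
  rw [boolAvg_realised hq]
  unfold boolAvg
  rw [sum_cube_append]
  simp_rw [hq, dec_eq_sum_slices, add_sub_cancel_left, div_pow]
  have hin : ∀ z : Fin N → Bool, ∑ y : Fin N → Bool, (∑ i, sgn (y i) *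
      ∑ S : Finset (Fin N), (if i ∈ S then cubeFourierCoeff (evalBool p) S *
        ∏ j ∈ S.erase i, sgn (z j) else 0)) ^ 2 / (2 * C) ^ 2 =
      (2 ^ N * ∑ i, (∑ S : Finset (Fin N), (if i ∈ S then cubeFourierCoeff (evalBool p) S *
        ∏ j ∈ S.erase i, sgn (z j) else 0)) ^ 2) / (2 * C) ^ 2 := by
    intro z
    rw [← Finset.sum_div, sum_sq_sum_sgn]
  rw [Finset.sum_comm]
  simp_rw [hin]
  rw [← Finset.sum_div, ← Finset.mul_sum, Finset.sum_comm]
  simp_rw [sum_sq_slice, influence_eq_sum_sq_fourier]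
  rw [← Finset.mul_sum, ← Finset.mul_sum, pow_add]
  field_simp
  ring

end StubComparison

end Summit.QuantumAdvantage.QuantumAdvantage.Cruxes.OneBlockDecoupling.OdonnellZhao

end
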